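import Literature.AlgebraicGeometry.Frobenioids.Composites
import Literature.AlgebraicGeometry.Frobenioids.IsometricPreSteps
import HarnessLib

/-!
# Frobenioids I: in any Frobenioid, a base-trivial object is isotropic and `Aut`-ample

Mochizuki, *The geometry of Frobenioids I: the general theory*, Kyushu J. Math. **62** (2008)
293–400, §1, Definition 1.2 (iv) p. 23 (base-trivial, `Aut`-ample, isotropic) and Definition 1.3
pp. 24–25 [cite: MochizukiFrdI2008, Def. 1.3 p.24]; used for Proposition 1.6 (v) p. 28 (the clause
«base-trivial», direction `C ⇒ C′`, whose "evident lifting argument needs an isomorphism of the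
`C`-component with PRESCRIBED projection to `D`" — abc-iut-found, `FiberProductsMorphisms.lean`).

OURS (abc-iut cell, finding F-t8g2-1 (B); a lemma not stated in the paper): `isAutAmple_of_isBaseTrivial`
— if `A` is base-trivial then every automorphism of `A_D` lifts to an automorphism of `A`.  PROOF
(from the axioms of Def. 1.3 only): base-trivial ⇒ isotropic ((vii)(a) + iso-invariance), so pre-steps
between objects base-isomorphic to `A` are co-angular ((v)(b)); (i)(b) gives co-angular pre-step
endomorphisms `a, b` of `A` with `Base(b) = Base(a) ≫ σ`; composing `a` with a base-identity
Frobenius endomorphism of degree `2` ((i)(a) + base-triviality) and refactoring by (iv)(a), (ii) yields a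
co-angular pre-step `a₂` with the same base and `Div a₂ = 2·Div a`; (iii)(d) (slice, full) applied to
`a₂ → a` produces `u ∈ O^▷(A)` with `Div u = Div a` (likewise `v` for `b`); then `v ≫ a` and `u ≫ b`
are co-angular pre-steps out of `A` with EQUAL divisors, so (iii)(d) (coslice, full) in both directions
gives an automorphism `χ` of `A` with `Base χ = σ`.  Nothing here bears on [IUTchIII].
-/

namespace Literature.AlgebraicGeometry.Frobenioids

open CategoryTheory Opposite

universe w v v' u u'

namespace PreFrobenioid

variable {D : Type u} [Category.{v} D] {Φ : Dᵒᵖ ⥤ CommMonCat.{w}}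
  {C : Type u'} [Category.{v'} C] {F : C ⥤ ElemFrobenioid Φ}

/-! ### Base-trivial objects are isotropic -/

/-- An object base-isomorphic to a base-trivial object is isomorphic to it (with the isomorphism in
the direction `A ≅ B`). [cite: MochizukiFrdI2008, Def. 1.2(iv) p.23] -/
theorem IsBaseTrivial.nonempty_iso {A B : C} (hA : IsBaseTrivial F A) (e : baseObj F A ≅ baseObj F B) :
    Nonempty (A ≅ B) :=
  ⟨(hA B ⟨e⟩).some.symm⟩

/-- A base-trivial object of a Frobenioid is isotropic (its isotropic hull is base-isomorphic, hence
isomorphic, to it). [cite: MochizukiFrdI2008, Def. 1.3(vii) p.25] -/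
theorem isIsotropic_of_isBaseTrivial (hF : IsFrobenioid F) {A : C} (hA : IsBaseTrivial F A) :
    IsIsotropic F A := by
  obtain ⟨B, φ, _, hφp, hB, _⟩ := hF.vii_a A
  haveI : IsIso (Base F φ) := hφp.2
  obtain ⟨e⟩ := hA.nonempty_iso (asIso (Base F φ))
  exact IsIsotropic.of_iso hF.isPreFrobenioid e hB

/-- Over a base-trivial object, every object base-isomorphic to it is isotropic. [cite: MochizukiFrdI2008, Def. 1.3(vii) p.25] -/
theorem isIsotropic_of_baseIsomorphic (hF : IsFrobenioid F) {A B : C} (hA : IsBaseTrivial F A)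
    (e : baseObj F A ≅ baseObj F B) : IsIsotropic F B := by
  obtain ⟨i⟩ := hA.nonempty_iso e
  exact IsIsotropic.of_iso hF.isPreFrobenioid i.symm (isIsotropic_of_isBaseTrivial hF hA)

/-- A pre-step whose source is base-isomorphic to a base-trivial object is co-angular (factor it by
(v)(b); the isometric factor leaves an isotropic object, so it is invertible). [cite: MochizukiFrdI2008, Def. 1.3(v) p.25] -/
theorem isCoAngular_of_isPreStep_of_isBaseTrivial (hF : IsFrobenioid F) {A X Y : C} (hA : IsBaseTrivial F A)
    (eX : baseObj F A ≅ baseObj F X) (φ : X ⟶ Y) (hφ : IsPreStep F φ) : IsCoAngular F φ := by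
  obtain ⟨X₁, β, α, hfac, hβ, hα⟩ := hF.v_b_exists φ hφ
  haveI : IsIso (Base F β) := hβ.2.2
  have hX₁ : IsIsotropic F X₁ := isIsotropic_of_baseIsomorphic hF hA (eX ≪≫ asIso (Base F β))
  haveI : IsIso α := hX₁ α hα.1 hα.2
  rw [← hfac]
  exact IsCoAngular.comp F hF hβ.1 (isCoAngular_of_isIso F hF.isPreFrobenioid.isTotallyEpimorphic α)

/-! ### A base-identity Frobenius endomorphism of degree `n` -/

/-- A base-trivial object of a Frobenioid carries, for every `n`, a base-identity endomorphism of
Frobenius type of degree `n` (transported from a Frobenius-trivial object of (i)(a)).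
[cite: MochizukiFrdI2008, Def. 1.3(i) p.24] -/
theorem exists_frobenius_endo_of_isBaseTrivial (hF : IsFrobenioid F) {A : C} (hA : IsBaseTrivial F A)
    (n : ℕ+) : ∃ f : A ⟶ A, IsBaseIdentity F f ∧ IsFrobeniusType F f ∧ degFr F f = n := by
  obtain ⟨A₀, ⟨ζ, hζ⟩, ⟨e₀⟩⟩ := hF.i_a (baseObj F A)
  obtain ⟨e⟩ := hA.nonempty_iso e₀.symm
  -- `e : A ≅ A₀`; transport `ζ n`
  obtain ⟨hdeg, hbid, hft⟩ := hζ n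
  refine ⟨e.hom ≫ (show A₀ ⟶ A₀ from ζ n) ≫ e.inv, ?_, ?_, ?_⟩
  · show Base F (e.hom ≫ (show A₀ ⟶ A₀ from ζ n) ≫ e.inv) = 𝟙 _
    rw [base_comp, base_comp, show Base F (show A₀ ⟶ A₀ from ζ n) = 𝟙 _ from hbid, Category.id_comp,
      ← base_comp, Iso.hom_inv_id, base_id]
  · exact IsFrobeniusType.comp F hF (isFrobeniusType_of_isIso F hF.isPreFrobenioid e.hom)
      (IsFrobeniusType.comp F hF hft (isFrobeniusType_of_isIso F hF.isPreFrobenioid e.inv))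
  · rw [degFr_comp, degFr_comp, hdeg, show degFr F e.hom = 1 from isLinear_of_isIso F e.hom,
      show degFr F e.inv = 1 from isLinear_of_isIso F e.inv, one_mul, mul_one]

/-! ### Scaling a co-angular pre-step endomorphism -/

/-- From a co-angular pre-step endomorphism `a` of a base-trivial `A` and a base-identity Frobenius
endomorphism `f` of degree `n`: a co-angular pre-step endomorphism with the same base as `a` and
divisor `Div(a)^n` (refactor `a ≫ f` by (iv)(a) and compare the Frobenius parts by (ii)).
[cite: MochizukiFrdI2008, Def. 1.3(iv) p.25] -/
theorem exists_scaled_endo (hF : IsFrobenioid F) {A : C} (hA : IsBaseTrivial F A) {a : A ⟶ A}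
    (ha : IsCoAngularPreStep F a) {f : A ⟶ A} (hfb : IsBaseIdentity F f) (hft : IsFrobeniusType F f) :
    ∃ q : A ⟶ A, IsCoAngularPreStep F q ∧ Base F q = Base F a ∧ Div F q = Div F a ^ (degFr F f : ℕ) := by
  have hD : IsTotallyEpimorphic D := hF.isPreFrobenioid.isTotallyEpimorphic_base
  obtain ⟨X, Y, γ, β, α, hfac, hγ, hβ, hα⟩ := hF.iv_a_exists (a ≫ f)
  -- degrees: `deg γ = deg f`
  haveI : IsIso (Base F a) := ha.2.2
  have hαlin : IsLinear F α := (hF.iv_b α hα).2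
  have hdegγ : degFr F γ = degFr F f := by
    have e := congrArg (degFr F) hfac
    rw [degFr_comp, degFr_comp, degFr_comp, show degFr F β = 1 from hβ.1, show degFr F α = 1 from hαlin,
      show degFr F a = 1 from ha.2.1, mul_one, mul_one, one_mul] at e
    exact e
  -- `γ ≅ f` over `A` by (ii)
  obtain ⟨ι, hι⟩ := hF.ii_unique f γ hft hγ hdegγ.symm
  -- `α` is a base-isomorphism, hence (being a pull-back) an isomorphism
  haveI : IsIso (Base F γ) := hγ.2
  haveI : IsIso (Base F β) := hβ.2
  haveI : IsIso (Base F (a ≫ f)) := by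
    rw [base_comp, show Base F f = 𝟙 _ from hfb, Category.comp_id]; infer_instance
  have hαb : IsBaseIso F α := by
    have e : Base F α = inv (Base F β) ≫ inv (Base F γ) ≫ Base F (a ≫ f) := by
      rw [← hfac, base_comp, base_comp]; simp
    show IsIso (Base F α)
    rw [e]; infer_instance
  haveI : IsIso α := (isPullbackMorphism_and_isBaseIso_iff_isIso F α).mp ⟨hα, hαb⟩
  have hfb' : Base F f = 𝟙 _ := hfb
  have hfz : Div F f = 1 := hft.1.2
  have key : f ≫ ι.hom ≫ β ≫ α = a ≫ f := by rw [← Category.assoc, hι, hfac]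
  refine ⟨ι.hom ≫ β ≫ α, ?_, ?_, ?_⟩
  · -- co-angular pre-step: pre-step (iso ≫ pre-step ≫ iso) out of `X ≅ A`, co-angular by base-triviality
    have hps : IsPreStep F (ι.hom ≫ β ≫ α) :=
      IsPreStep.comp F (isPreStep_of_isIso F ι.hom) (IsPreStep.comp F hβ (isPreStep_of_isIso F α))
    exact ⟨isCoAngular_of_isPreStep_of_isBaseTrivial hF hA (Iso.refl _) _ hps, hps⟩
  · -- bases: apply `Base` to `f ≫ q = a ≫ f` and use `Base f = id`
    have e := congrArg (Base F) key
    rw [base_comp F f, base_comp F a f, hfb', Category.id_comp, Category.comp_id] at e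
    exact e
  · -- divisors: apply `Div` to `f ≫ q = a ≫ f`; `Base f = id`, `Div f = 0`
    have e := congrArg (Div F) key
    rw [div_comp F f, div_comp F a f, hfb', pull_id, hfz, one_pow, mul_one, map_one, one_mul] at e
    exact e

/-! ### The lifting theorem -/

/-- Cancellation in the (integral) divisor monoid `Φ(A)` of a Frobenioid. [cite: MochizukiFrdI2008, Def. 1.1(i) p.19] -/
theorem div_mul_left_cancel (hF : IsFrobenioid F) {A : C} {x y z : Φ.obj (op (baseObj F A))}
    (h : x * y = x * z) : y = z := by
  haveI : IsCancelMul (Φ.obj (op (baseObj F A))) :=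
    isIntegral_iff_isCancelMul.mp (hF.isPreFrobenioid.isDivisorial (baseObj F A)).isPreDivisorial.isIntegral
  exact mul_left_cancel h

/-- From a co-angular pre-step endomorphism `a` of a base-trivial `A`: an element `u ∈ O^▷(A)`
(base-identity co-angular pre-step) with `Div u = Div a`. [cite: MochizukiFrdI2008, Def. 1.3(iii) p.24] -/
theorem exists_baseIdentity_same_div (hF : IsFrobenioid F) {A : C} (hA : IsBaseTrivial F A) {a : A ⟶ A}
    (ha : IsCoAngularPreStep F a) :
    ∃ u : A ⟶ A, IsCoAngularPreStep F u ∧ IsBaseIdentity F u ∧ Div F u = Div F a := by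
  obtain ⟨f, hfb, hft, hfd⟩ := exists_frobenius_endo_of_isBaseTrivial hF hA 2
  obtain ⟨q, hq, hqb, hqd⟩ := exists_scaled_endo hF hA ha hfb hft
  rw [hfd] at hqd
  haveI : IsIso (Base F a) := ha.2.2
  haveI : IsIso (Base F q) := hq.2.2
  have hqd' : Div F q = Div F a * Div F a := by rw [hqd, show ((2 : ℕ+) : ℕ) = 2 from rfl, pow_two]
  -- (iii)(d), slice over `A`: `invDiv a ∣ invDiv q`
  have hinv : inv (Base F q) = inv (Base F a) := IsIso.inv_eq_inv.mpr hqb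
  have hdvd : invDiv F a ha.2.2 ∣ invDiv F q hq.2.2 := by
    refine ⟨invDiv F a ha.2.2, ?_⟩
    unfold invDiv
    rw [hinv, hqd', map_mul]
  obtain ⟨u, hu, hua⟩ := hF.iii_d_over_full q a hq ha hdvd
  have hub : Base F u = 𝟙 _ := by
    have e := congrArg (Base F) hua
    rw [base_comp F u a, hqb] at e
    exact (cancel_mono (Base F a)).mp (by rw [e, Category.id_comp])
  refine ⟨u, hu, hub, ?_⟩
  have e := congrArg (Div F) hua
  rw [div_comp F u a, hub, pull_id, show degFr F a = 1 from ha.2.1, PNat.one_coe, pow_one, hqd'] at e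
  exact div_mul_left_cancel hF e

/-- **In a Frobenioid, a base-trivial object is `Aut`-ample**: every automorphism of `A_D` is the base
of an automorphism of `A` (ours; the input that makes the «base-trivial» clause of Prop. 1.6 (v)
transfer to `C′ = C ×_D D′`). [cite: MochizukiFrdI2008, Def. 1.2(iv) p.23] -/
theorem isAutAmple_of_isBaseTrivial (hF : IsFrobenioid F) {A : C} (hA : IsBaseTrivial F A) : IsAutAmple F A := by
  intro σ
  have hC : IsTotallyEpimorphic C := hF.isPreFrobenioid.isTotallyEpimorphic
  -- (i)(b): a pre-step span realising `σ`, moved to endomorphisms of `A`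
  obtain ⟨X, φ, ψ, hφ, hψ, hspan⟩ := hF.i_b A A σ
  haveI : IsIso (Base F φ) := hφ.2
  obtain ⟨θ⟩ := hA.nonempty_iso (asIso (Base F φ)).symm
  -- θ : A ≅ X
  have ha' : IsPreStep F (θ.hom ≫ φ) := IsPreStep.comp F (isPreStep_of_isIso F θ.hom) hφ
  have hb' : IsPreStep F (θ.hom ≫ ψ) := IsPreStep.comp F (isPreStep_of_isIso F θ.hom) hψ
  have ha : IsCoAngularPreStep F (θ.hom ≫ φ) :=
    ⟨isCoAngular_of_isPreStep_of_isBaseTrivial hF hA (Iso.refl _) _ ha', ha'⟩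
  have hb : IsCoAngularPreStep F (θ.hom ≫ ψ) :=
    ⟨isCoAngular_of_isPreStep_of_isBaseTrivial hF hA (Iso.refl _) _ hb', hb'⟩
  have hab : Base F (θ.hom ≫ φ) ≫ σ.hom = Base F (θ.hom ≫ ψ) := by
    rw [base_comp, base_comp, Category.assoc]
    congr 1
  -- units with the divisors of `a`, `b`
  obtain ⟨u, hu, hub, hud⟩ := exists_baseIdentity_same_div hF hA ha
  obtain ⟨v, hv, hvb, hvd⟩ := exists_baseIdentity_same_div hF hA hb
  have hub' : Base F u = 𝟙 _ := hub
  have hvb' : Base F v = 𝟙 _ := hvb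
  -- the two co-angular pre-steps out of `A` with equal divisors
  have hc₁c : IsCoAngularPreStep F (v ≫ θ.hom ≫ φ) := ⟨IsCoAngular.comp F hF hv.1 ha.1, IsPreStep.comp F hv.2 ha.2⟩
  have hc₂c : IsCoAngularPreStep F (u ≫ θ.hom ≫ ψ) := ⟨IsCoAngular.comp F hF hu.1 hb.1, IsPreStep.comp F hu.2 hb.2⟩
  have hdiv : Div F (v ≫ θ.hom ≫ φ) = Div F (u ≫ θ.hom ≫ ψ) := by
    rw [div_comp F v (θ.hom ≫ φ), div_comp F u (θ.hom ≫ ψ), hvb', hub', pull_id, pull_id,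
      show degFr F (θ.hom ≫ φ) = 1 from ha.2.1, show degFr F (θ.hom ≫ ψ) = 1 from hb.2.1, PNat.one_coe,
      pow_one, pow_one, hud, hvd, mul_comm]
  obtain ⟨g, -, hg₁⟩ := hF.iii_d_under_full _ _ hc₁c hc₂c (hdiv ▸ dvd_refl _)
  obtain ⟨g', -, hg₂⟩ := hF.iii_d_under_full _ _ hc₂c hc₁c (hdiv ▸ dvd_refl _)
  haveI := hC.epi (v ≫ θ.hom ≫ φ)
  haveI := hC.epi (u ≫ θ.hom ≫ ψ)
  have hgg' : g ≫ g' = 𝟙 _ := by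
    apply (cancel_epi (v ≫ θ.hom ≫ φ)).mp
    rw [← Category.assoc, hg₁, hg₂, Category.comp_id]
  have hg'g : g' ≫ g = 𝟙 _ := by
    apply (cancel_epi (u ≫ θ.hom ≫ ψ)).mp
    rw [← Category.assoc, hg₂, hg₁, Category.comp_id]
  -- its base is `σ`
  have hbase : Base F g = σ.hom := by
    have e := congrArg (Base F) hg₁
    rw [base_comp F (v ≫ θ.hom ≫ φ) g, base_comp F v (θ.hom ≫ φ), base_comp F u (θ.hom ≫ ψ), hvb', hub',
      Category.id_comp, Category.id_comp, ← hab] at e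
    haveI : IsIso (Base F (θ.hom ≫ φ)) := ha.2.2
    exact (cancel_epi (Base F (θ.hom ≫ φ))).mp e
  exact ⟨⟨g, g', hgg', hg'g⟩, Iso.ext hbase⟩

/-- A base-trivial object of a Frobenioid is Frobenius-ample (degree-`n` endomorphisms exist).
[cite: MochizukiFrdI2008, Def. 1.2(iv) p.22] -/
theorem isFrobeniusAmple_of_isBaseTrivial (hF : IsFrobenioid F) {A : C} (hA : IsBaseTrivial F A) :
    IsFrobeniusAmple F A := fun n => by
  obtain ⟨f, -, -, hf⟩ := exists_frobenius_endo_of_isBaseTrivial hF hA n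
  exact ⟨f, hf⟩

end PreFrobenioid

end Literature.AlgebraicGeometry.Frobenioids
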